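import Literature.MathematicalPhysics.QuantumFieldTheory.ContinuumLimitsTrivialityAssemblyProofs
import Literature.MathematicalPhysics.QuantumLattice.LatticeScalarFieldProofs
import Mathlib.Analysis.Calculus.BumpFunction.FiniteDimension
import HarnessLib

/-!
# `phi44_triviality` from the printed exponential-moment estimate: the thermodynamic limit identified

Sibling proofs file of `Literature/MathematicalPhysics/QuantumFieldTheory/ContinuumLimits.lean`
(constructive-qft.S24), continuing `ContinuumLimitsTrivialityAssemblyProofs.lean`. Theorems and
three real definitions only: **no statement of the tree is changed and no named fact is
introduced** (D-0026).

Aizenman–Duminil-Copin (Ann. Math. 194 (2021), arXiv:1912.07973) deduce Thm 1.2 ("Gaussianity of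
`Φ⁴₄`": every scaling limit of the lattice `φ⁴₄` fields of Def. 1.1 is a generalized Gaussian
process) from the exponential-moment estimate Prop. 7.2 (p. 28, Griffiths–Simon class, which
contains lattice `φ⁴` by §2) and the two-sided variance bound printed on p. 6. The tree renders
Thm 1.2 for lattice `φ⁴₄` as the named fact `phi44_triviality` (thermodynamic limit in law `ν_δ`
of the free-boundary box laws first, then `δ → 0⁺` inside the window `L ≤ M ξ`), and
`ContinuumLimitsTrivialityAssemblyProofs` proves the law-level assembly
`phi44_triviality_of_scaleBound`, whose hypothesis is Prop. 7.2 + p. 6 *transcribed for the laws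
`ν_δ`*. This file closes the remaining model-independent gap — the identification of `ν_δ` with
the printed infinite-volume state and the dilation/normalisation bookkeeping — and proves

* `phi44_triviality_of_prop72`: **`phi44_triviality` follows from Prop. 7.2 and the p. 6 variance
  bounds stated verbatim at the level of the printed objects**: the free-boundary infinite-volume
  lattice `φ⁴` state on `ℤ⁴` as the box limit of `phi4BoxMeasure` expectations (`phi4BoxExpect`,
  `HasBoxLimit`; ADC §5, p. 16, "the states' natural infinite volume limit"), the block variance
  `Σ_L` (`phi4BlockVariance`) and the normalised field `T_{f,L} = Σ_L^{-1/2} ∑_x f(x/L) φ_x`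
  (`phi4NormalizedField`), the window `L ≤ ξ` written as for the Ising twin
  `Literature.Probability.LatticeModels.aizenmanDuminilCopin_mgf_normalizedField_bound_abs`.

so that what remains to vendor for `phi44_triviality_holds` is exactly the printed `φ⁴₄`
substance (Prop. 7.2 via Thm 7.1 — random currents for the GS class, the multi-scale improved tree
diagram bound, the regularity inputs of §5 — and the p. 6 variance bounds), as two statements of
the same shape as the Ising named facts of `Literature/Probability/LatticeModels/HighDimTriviality.lean`.

## Contents

* Lattice sums of a real field against compactly supported functions (`finsum_smearField_eq_sum`,
  `eventually_finLatticeField_box_eq`: the smeared box field `Φ_{δ,R}(f)` of `finLatticeField` is,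
  for all large boxes, the full lattice sum `ρ δᵈ ∑_x f(δx) φ_x`).
* Exponential integrability under the lattice `φ⁴` measures for `g > 0`
  (`integrable_phi4Measure_of_norm_le_exp`: Gaussian domination from the stability bound
  `neg_phi4Action_le` of `LatticeScalarFieldProofs`; `integrable_exp_sum_mul_phi4FreeMeasure`,
  moments of order `2` and `4`).
* **Identification** (`integral_exp_eval_eq_of_thermodynamicLimit`,
  `integral_sq_eval_eq_of_thermodynamicLimit`): if `ν` is the limit in law of the box laws of
  `Φ_{δ,R}(f)` and the box expectations of `e^{t S}` (`S` the full lattice sum) converge for all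
  real `t`, then the exponential and second moments of `ω(f)` under `ν` are those limits — by
  `tendsto_integral_exp_eval_of_tendstoInLaw` / `tendsto_integral_sq_eval_of_tendstoInLaw` of the
  assembly file, the uniform bounds coming from the convergent moments at `2t`, `±1`.
* The printed objects `phi4BoxExpect`, `phi4BlockVariance`, `phi4NormalizedField` (twins of
  `blockSpinVariance`, `normalizedField` of `HighDimTriviality`), the dilation
  `f ↦ f(·/M)` reducing the window `L ≤ M ξ` to the printed `L ≤ ξ`
  (`fullSum_eq_mul_phi4NormalizedField`: `ρ δᵈ ∑_x f(δx) φ_x = ρ δᵈ Σ_L^{1/2} · T_{f(·/M), L}`,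
  `L = (Mδ)⁻¹`), a compactly supported Schwartz bump (`exists_schwartz_cubeBump`), and the assembly
  `phi44_triviality_of_prop72`.

## What is NOT here

Prop. 7.2 / Thm 7.1 and the p. 6 variance bounds themselves (the `φ⁴₄` substance of the source),
and hence `phi44_triviality_holds`; the existence of the box limits (thermodynamic limit of the
free-boundary lattice `φ⁴` correlations by the Griffiths inequalities of
`LatticeScalarFieldGriffithsProofs`) is not proved here either — it enters through the hypotheses,
as the printed statements are about the infinite-volume state.

## References

* M. Aizenman, H. Duminil-Copin, *Marginal triviality of the scaling limits of critical 4D Ising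
  and `φ⁴₄` models*, Ann. Math. 194 (2021) 163–235, arXiv:1912.07973 (held, arXiv pagination):
  Def. 1.1 and Thm 1.2 (p. 4), Prop. 1.4 and the display after it (p. 6), §2 (p. 7, GS class),
  §5 (p. 16: `⟨·⟩_{Λ,ρ,β}`, `⟨·⟩_{ρ,β}`, `ξ(ρ,β)`), §6.3 (p. 26), Thm 7.1 and Prop. 7.2 (p. 28)
  [AizenmanDuminilCopinAnnals2021].
* J. Glimm, A. Jaffe, *Quantum Physics* (2nd ed. 1987), §6.1 (laws on `𝒮'`), §9.5–9.6 (lattice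
  `φ⁴` measures) [GlimmJaffe1987].

## Mathlib / tree

`MeasureTheory.integrable_tilted_iff`, `integrable_map_measure`, `integral_map`,
`ContDiffBump`, `HasCompactSupport.toSchwartzMap`, `tendsto_inv_nhdsGT_zero`,
`tendsto_rpow_atTop`; from the tree `phi44_triviality_of_scaleBound`,
`tendsto_integral_exp_eval_of_tendstoInLaw`, `tendsto_integral_sq_eval_of_tendstoInLaw`,
`pow_four_le_exp_add_exp_neg` (`ContinuumLimitsTrivialityAssemblyProofs`),
`isProbabilityMeasure_phi4BoxMeasure` (`ContinuumLimitsTrivialityProofs`), `neg_phi4Action_le`,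
`integrable_exp_neg_phi4Action` (`LatticeScalarFieldProofs`), `latticeBox`, `HasBoxLimit`, `boxLim`
(`HighDimTriviality`, `ThermodynamicLimit`).
-/

noncomputable section

open scoped SchwartzMap NNReal
open MeasureTheory Filter Topology ProbabilityTheory
open Literature.MathematicalPhysics.QuantumLattice (FieldConfig TendstoInLaw phi4Measure phi4FreeMeasure
  phi4BoxMeasure phi4CriticalJ phi4TwoPoint phi4Action latticeFieldLaw finLatticeField
  finLatticeField_apply siteToE siteToE_apply glueZero zdGraphIn measurable_finLatticeField
  measurable_eval integrable_exp_neg_phi4Action neg_phi4Action_le measurable_glueZero)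
open Literature.Probability.LatticeModels (box latticeBox mem_latticeBox latticeBox_eq_box box_mono
  HasBoxLimit boxLim invCorrLength glueWith_apply_mem glueWith_apply_not_mem cube_of_comp_inv_smul
  exists_cube_of_hasCompactSupport)
open Literature.Probability.LatticeModels renaming Site → LSite

namespace Literature.MathematicalPhysics.QuantumFieldTheory

variable {d : ℕ}

/-! ### Lattice sums of a real field against compactly supported functions -/

/-- For `δ ≠ 0` and `f` vanishing outside `[-r, r]ᵈ`, the full lattice sum `∑_x f(δ x) φ_x` of a
real lattice field is a finite sum over the box `Λ_{r/|δ|}`. [folklore] -/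
theorem finsum_smearField_eq_sum {f : EuclideanSpace ℝ (Fin d) → ℝ} {r δ : ℝ} (hδ : δ ≠ 0)
    (hf : ∀ x, f x ≠ 0 → ∀ i, |x i| ≤ r) (φ : LSite d → ℝ) :
    ∑ᶠ x : LSite d, f (δ • siteToE x) * φ x =
      ∑ x ∈ latticeBox d (r / |δ|), f (δ • siteToE x) * φ x := by
  apply finsum_eq_finsetSum_of_support_subset
  intro x hx
  rw [Function.mem_support] at hx
  have hfx : f (δ • siteToE x) ≠ 0 := fun h => hx (by rw [h, zero_mul])
  rw [Finset.mem_coe, mem_latticeBox]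
  intro i
  have h := hf _ hfx i
  rw [PiLp.smul_apply, siteToE_apply, smul_eq_mul, abs_mul] at h
  rw [le_div_iff₀ (abs_pos.mpr hδ), mul_comm]
  exact h

/-- A box sum of `f(δ x) φ_x` over any finite set containing `Λ_{r/|δ|}` is the full lattice sum
(the extra terms vanish). [folklore] -/
theorem sum_smearField_eq_finsum {f : EuclideanSpace ℝ (Fin d) → ℝ} {r δ : ℝ} (hδ : δ ≠ 0)
    (hf : ∀ x, f x ≠ 0 → ∀ i, |x i| ≤ r) {Λ : Finset (LSite d)}
    (hΛ : latticeBox d (r / |δ|) ⊆ Λ) (φ : LSite d → ℝ) :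
    ∑ x ∈ Λ, f (δ • siteToE x) * φ x = ∑ᶠ x : LSite d, f (δ • siteToE x) * φ x := by
  rw [finsum_smearField_eq_sum hδ hf]
  symm
  refine Finset.sum_subset hΛ fun x _ hx => ?_
  have hfx : f (δ • siteToE x) = 0 := by
    by_contra h
    refine hx (mem_latticeBox.2 fun i => ?_)
    have h' := hf _ h i
    rw [PiLp.smul_apply, siteToE_apply, smul_eq_mul, abs_mul] at h'
    rw [le_div_iff₀ (abs_pos.mpr hδ), mul_comm]
    exact h'
  rw [hfx, zero_mul]

/-- The boxes `box d R` eventually contain `Λ_{L}`. [folklore] -/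
theorem eventually_latticeBox_subset_box (d : ℕ) (L : ℝ) :
    ∀ᶠ R : ℕ in atTop, latticeBox d L ⊆ box d R := by
  rcases le_or_gt 0 L with hL | hL
  · filter_upwards [eventually_ge_atTop ⌊L⌋₊] with R hR
    rw [latticeBox_eq_box hL]
    exact box_mono d hR
  · refine Eventually.of_forall fun R x hx => ?_
    rw [mem_latticeBox] at hx
    rw [Literature.Probability.LatticeModels.mem_box]
    intro i
    exact absurd ((hx i).trans_lt hL) (not_lt.2 (abs_nonneg _))

/-- **The smeared box field is eventually the full lattice sum**: for `δ ≠ 0`, `f` vanishing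
outside `[-r, r]ᵈ` and all large boxes `box d R`,
`Φ_{δ,R}(f)(φ) = ρ δᵈ ∑_{x ∈ box d R} f(δ x) φ_x = ρ δᵈ ∑_{x ∈ ℤᵈ} f(δ x) φ_x` for every `φ`.
[folklore] -/
theorem eventually_finLatticeField_box_eq {r δ : ℝ} (hδ : δ ≠ 0) (ρ : ℝ)
    (f : 𝓢(EuclideanSpace ℝ (Fin d), ℝ)) (hf : ∀ x, f x ≠ 0 → ∀ i, |x i| ≤ r) :
    ∀ᶠ R : ℕ in atTop, ∀ φ : LSite d → ℝ,
      finLatticeField (box d R) δ ρ φ f = ρ * δ ^ d * ∑ᶠ x : LSite d, f (δ • siteToE x) * φ x := by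
  filter_upwards [eventually_latticeBox_subset_box d (r / |δ|)] with R hR φ
  rw [finLatticeField_apply, ← sum_smearField_eq_finsum hδ hf hR φ, Finset.mul_sum]
  exact Finset.sum_congr rfl fun x _ => by ring


/-! ### Exponential integrability under the lattice `φ⁴` measures -/

section Graph

variable {V : Type*} [Fintype V] (G : SimpleGraph V) [DecidableRel G.Adj]

/-- **Gaussian domination under the lattice `φ⁴` Gibbs measure**: for `g > 0`, any
(a.e. strongly measurable) observable bounded by `A · exp(½ ∑_y ψ_y²)` is integrable under
`phi4Measure G g κ J` — by the stability bound `−S(ψ) ≤ C − ∑_y ψ_y²`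
(`neg_phi4Action_le`), `e^{−S} · A e^{½∑ψ²} ≤ A e^{C} ∏_y e^{−½ψ_y²}`. [folklore] -/
theorem integrable_phi4Measure_of_norm_le_exp {g : ℝ} (hg : 0 < g) (κ J : ℝ)
    {F : (V → ℝ) → ℝ} (hF : AEStronglyMeasurable F (volume : Measure (V → ℝ))) {A : ℝ}
    (hle : ∀ ψ, ‖F ψ‖ ≤ A * Real.exp ((1 / 2) * ∑ y, ψ y ^ 2)) :
    Integrable F (phi4Measure G g κ J) := by
  unfold phi4Measure
  rw [integrable_tilted_iff (integrable_exp_neg_phi4Action G hg κ J)]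
  obtain ⟨C, hC⟩ : ∃ C : ℝ, ∀ φ : V → ℝ, -phi4Action G g κ J φ ≤ C - ∑ x, φ x ^ 2 :=
    ⟨_, neg_phi4Action_le G hg κ J⟩
  have hprod : Integrable (fun φ : V → ℝ => ∏ x, Real.exp (-(1 / 2) * φ x ^ 2)) := by
    have h := Integrable.fintype_prod (ι := V)
      (f := fun (_ : V) (t : ℝ) => Real.exp (-(1 / 2) * t ^ 2)) (μ := fun _ => (volume : Measure ℝ))
      fun _ => integrable_exp_neg_mul_sq (by norm_num : (0 : ℝ) < 1 / 2)
    rwa [← volume_pi] at h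
  refine (hprod.const_mul (A * Real.exp C)).mono' ?_ (Eventually.of_forall fun φ => ?_)
  · exact ((by fun_prop : Measurable fun φ : V → ℝ =>
      Real.exp (-phi4Action G g κ J φ)).aestronglyMeasurable).smul hF
  have hprodexp : ∏ x, Real.exp (-(1 / 2) * φ x ^ 2) = Real.exp (-(1 / 2) * ∑ x, φ x ^ 2) := by
    rw [Finset.mul_sum, Real.exp_sum]
  rw [hprodexp, norm_smul, Real.norm_of_nonneg (Real.exp_pos _).le]
  have hA : 0 ≤ A := by
    have h := (norm_nonneg _).trans (hle φ)
    exact nonneg_of_mul_nonneg_left h (Real.exp_pos _) |> fun h' => by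
      rcases le_or_gt 0 A with hA | hA
      · exact hA
      · exact absurd h (not_le.2 (mul_neg_of_neg_of_pos hA (Real.exp_pos _)))
  calc Real.exp (-phi4Action G g κ J φ) * ‖F φ‖
      ≤ Real.exp (C - ∑ x, φ x ^ 2) * (A * Real.exp ((1 / 2) * ∑ y, φ y ^ 2)) :=
        mul_le_mul (Real.exp_le_exp.2 (hC φ)) (hle φ) (norm_nonneg _) (Real.exp_pos _).le
    _ = A * Real.exp C * Real.exp (-(1 / 2) * ∑ x, φ x ^ 2) := by
        rw [show C - ∑ x, φ x ^ 2 = C + (-(∑ x, φ x ^ 2)) by ring, Real.exp_add]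
        rw [mul_mul_mul_comm, ← Real.exp_add, mul_comm (Real.exp C) A]
        congr 1
        congr 1
        ring

/-- The exponential of a linear functional of the fields is integrable under the lattice `φ⁴`
Gibbs measure (`g > 0`): `c u ≤ ½u² + ½c²`. [folklore] -/
theorem integrable_exp_sum_mul_phi4Measure {g : ℝ} (hg : 0 < g) (κ J : ℝ) (c : V → ℝ) :
    Integrable (fun ψ : V → ℝ => Real.exp (∑ y, c y * ψ y)) (phi4Measure G g κ J) := by
  refine integrable_phi4Measure_of_norm_le_exp G hg κ J
    (by fun_prop : Measurable fun ψ : V → ℝ => Real.exp (∑ y, c y * ψ y)).aestronglyMeasurable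
    (A := Real.exp ((1 / 2) * ∑ y, c y ^ 2)) fun ψ => ?_
  rw [Real.norm_of_nonneg (Real.exp_pos _).le, ← Real.exp_add, Real.exp_le_exp, Finset.mul_sum,
    Finset.mul_sum, ← Finset.sum_add_distrib]
  refine Finset.sum_le_sum fun y _ => ?_
  nlinarith [sq_nonneg (ψ y - c y)]

end Graph

/-- Restriction of a lattice sum of squares of an extension by zero: for `ψ : Λ → ℝ`,
`∑_{x ∈ S} (glueZero Λ ψ)_x² ≤ ∑_{y ∈ Λ} ψ_y²`. [folklore] -/
theorem sum_sq_glueZero_le (Λ S : Finset (LSite d)) (ψ : Λ → ℝ) :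
    ∑ x ∈ S, glueZero Λ ψ x ^ 2 ≤ ∑ y, ψ y ^ 2 := by
  classical
  rw [← Finset.sum_filter_add_sum_filter_not S (· ∈ Λ)]
  have h0 : ∑ x ∈ S with ¬ x ∈ Λ, glueZero Λ ψ x ^ 2 = 0 := by
    refine Finset.sum_eq_zero fun x hx => ?_
    rw [Finset.mem_filter] at hx
    simp only [glueZero, glueWith_apply_not_mem Λ ψ 0 hx.2, Pi.zero_apply, zero_pow two_ne_zero]
  rw [h0, add_zero]
  calc ∑ x ∈ S with x ∈ Λ, glueZero Λ ψ x ^ 2 ≤ ∑ x ∈ Λ, glueZero Λ ψ x ^ 2 :=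
        Finset.sum_le_sum_of_subset_of_nonneg (fun x hx => (Finset.mem_filter.1 hx).2)
          fun x _ _ => sq_nonneg _
    _ = ∑ y, ψ y ^ 2 := by
        rw [← Finset.sum_coe_sort Λ]
        exact Finset.sum_congr rfl fun y _ => by
          simp only [glueZero, glueWith_apply_mem Λ ψ 0 y.2]

/-- A finite lattice sum `φ ↦ ∑_{x ∈ S} c_x φ_x` is measurable for the product σ-algebra on
`ℤᵈ → ℝ`. [folklore] -/
@[fun_prop]
theorem measurable_sum_mul_apply (S : Finset (LSite d)) (c : LSite d → ℝ) :
    Measurable fun φ : LSite d → ℝ => ∑ x ∈ S, c x * φ x :=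
  Finset.measurable_sum S fun x _ =>
    ((continuous_apply x).measurable : Measurable fun φ : LSite d → ℝ => φ x).const_mul (c x)

/-- **Exponential integrability under the free-boundary `φ⁴` measures on `ℤᵈ`**: for `g > 0`,
every finite volume `Λ`, finite `S ⊆ ℤᵈ` and coefficients `c`,
`φ ↦ exp(∑_{x ∈ S} c_x φ_x)` is integrable under `phi4FreeMeasure d Λ g κ J`. [folklore] -/
theorem integrable_exp_sum_mul_phi4FreeMeasure (Λ : Finset (LSite d)) {g : ℝ} (hg : 0 < g)
    (κ J : ℝ) (S : Finset (LSite d)) (c : LSite d → ℝ) :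
    Integrable (fun φ : LSite d → ℝ => Real.exp (∑ x ∈ S, c x * φ x))
      (phi4FreeMeasure d Λ g κ J) := by
  classical
  unfold phi4FreeMeasure
  rw [integrable_map_measure
    (by fun_prop : Measurable fun φ : LSite d → ℝ =>
      Real.exp (∑ x ∈ S, c x * φ x)).aestronglyMeasurable
    (measurable_glueZero Λ).aemeasurable]
  refine integrable_phi4Measure_of_norm_le_exp (zdGraphIn d Λ) hg κ J ?_
    (A := Real.exp ((1 / 2) * ∑ x ∈ S, c x ^ 2)) fun ψ => ?_
  · exact ((by fun_prop : Measurable fun φ : LSite d → ℝ => Real.exp (∑ x ∈ S, c x * φ x)).comp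
      (measurable_glueZero Λ)).aestronglyMeasurable
  rw [Function.comp_apply, Real.norm_of_nonneg (Real.exp_pos _).le, ← Real.exp_add,
    Real.exp_le_exp]
  have h1 : ∑ x ∈ S, c x * glueZero Λ ψ x ≤
      (1 / 2) * ∑ x ∈ S, c x ^ 2 + (1 / 2) * ∑ x ∈ S, glueZero Λ ψ x ^ 2 := by
    rw [Finset.mul_sum, Finset.mul_sum, ← Finset.sum_add_distrib]
    refine Finset.sum_le_sum fun x _ => ?_
    nlinarith [sq_nonneg (glueZero Λ ψ x - c x)]
  have h2 := sum_sq_glueZero_le Λ S ψ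
  nlinarith

/-- Scaled form: `φ ↦ exp(t ∑_{x ∈ S} c_x φ_x)` is integrable under `phi4FreeMeasure`.
[folklore] -/
theorem integrable_exp_mul_sum_phi4FreeMeasure (Λ : Finset (LSite d)) {g : ℝ} (hg : 0 < g)
    (κ J : ℝ) (S : Finset (LSite d)) (c : LSite d → ℝ) (t : ℝ) :
    Integrable (fun φ : LSite d → ℝ => Real.exp (t * ∑ x ∈ S, c x * φ x))
      (phi4FreeMeasure d Λ g κ J) := by
  have h := integrable_exp_sum_mul_phi4FreeMeasure Λ hg κ J S (fun x => t * c x)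
  refine h.congr (Eventually.of_forall fun φ => ?_)
  simp only [Finset.mul_sum, mul_assoc]

/-- `u² ≤ 24 (e^u + e^{-u})` (crude; from `u² ≤ 1 + u⁴/4` and `u⁴ ≤ 24(e^u + e^{-u})`).
[folklore] -/
theorem sq_le_exp_add_exp_neg (u : ℝ) : u ^ 2 ≤ 24 * (Real.exp u + Real.exp (-u)) := by
  have h1 : u ^ 4 ≤ 24 * (Real.exp u + Real.exp (-u)) := pow_four_le_exp_add_exp_neg u
  have h2 : (2 : ℝ) ≤ Real.exp u + Real.exp (-u) := by
    have := Real.add_one_le_exp u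
    have := Real.add_one_le_exp (-u)
    linarith
  nlinarith [sq_nonneg (u ^ 2 / 2 - 1)]

/-- Even powers `2` and `4` of a finite lattice sum are integrable under `phi4FreeMeasure`
(dominated by exponential moments). [folklore] -/
theorem integrable_pow_sum_phi4FreeMeasure (Λ : Finset (LSite d)) {g : ℝ} (hg : 0 < g)
    (κ J : ℝ) (S : Finset (LSite d)) (c : LSite d → ℝ) {n : ℕ} (hn : n = 2 ∨ n = 4) :
    Integrable (fun φ : LSite d → ℝ => (∑ x ∈ S, c x * φ x) ^ n)
      (phi4FreeMeasure d Λ g κ J) := by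
  have hdom : Integrable (fun φ : LSite d → ℝ => 24 * (Real.exp (1 * ∑ x ∈ S, c x * φ x) +
      Real.exp ((-1) * ∑ x ∈ S, c x * φ x))) (phi4FreeMeasure d Λ g κ J) :=
    ((integrable_exp_mul_sum_phi4FreeMeasure Λ hg κ J S c 1).add
      (integrable_exp_mul_sum_phi4FreeMeasure Λ hg κ J S c (-1))).const_mul 24
  refine hdom.mono' ((measurable_sum_mul_apply S c).pow_const n).aestronglyMeasurable
    (Eventually.of_forall fun φ => ?_)
  set u : ℝ := ∑ x ∈ S, c x * φ x
  rw [one_mul, neg_one_mul, Real.norm_eq_abs]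
  rcases hn with rfl | rfl
  · rw [abs_of_nonneg (by positivity)]
    exact sq_le_exp_add_exp_neg u
  · rw [abs_of_nonneg (by positivity)]
    exact pow_four_le_exp_add_exp_neg u


/-! ### Laws of the smeared box fields: integrals and integrability -/

/-- Integrals of functions of `ω(f)` under the law of the smeared field are integrals over the
lattice configurations. [folklore] -/
theorem integral_latticeFieldLaw_eval (μ : Measure (LSite d → ℝ)) (Λ : Finset (LSite d))
    (δ ρ : ℝ) (f : 𝓢(EuclideanSpace ℝ (Fin d), ℝ)) {F : ℝ → ℝ} (hF : Measurable F) :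
    ∫ ω, F (ω f) ∂(latticeFieldLaw μ Λ δ ρ) = ∫ φ, F (finLatticeField Λ δ ρ φ f) ∂μ := by
  unfold latticeFieldLaw
  rw [integral_map (measurable_finLatticeField Λ δ ρ).aemeasurable]
  exact (hF.comp (measurable_eval f)).aestronglyMeasurable

/-- Integrability of functions of `ω(f)` under the law of the smeared field. [folklore] -/
theorem integrable_latticeFieldLaw_eval_iff (μ : Measure (LSite d → ℝ)) (Λ : Finset (LSite d))
    (δ ρ : ℝ) (f : 𝓢(EuclideanSpace ℝ (Fin d), ℝ)) {F : ℝ → ℝ} (hF : Measurable F) :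
    Integrable (fun ω : FieldConfig (EuclideanSpace ℝ (Fin d)) => F (ω f)) (latticeFieldLaw μ Λ δ ρ) ↔
      Integrable (fun φ => F (finLatticeField Λ δ ρ φ f)) μ := by
  unfold latticeFieldLaw
  exact integrable_map_measure (hF.comp (measurable_eval f)).aestronglyMeasurable
    (measurable_finLatticeField Λ δ ρ).aemeasurable

/-- The smeared box field `Φ_{δ,Λ}(f)(φ) = ∑_{x ∈ Λ} c_x φ_x` with `c_x = ρ δᵈ f(δ x)`.
[folklore] -/
theorem finLatticeField_apply_eq_sum (Λ : Finset (LSite d)) (δ ρ : ℝ) (φ : LSite d → ℝ)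
    (f : 𝓢(EuclideanSpace ℝ (Fin d), ℝ)) :
    finLatticeField Λ δ ρ φ f = ∑ x ∈ Λ, (ρ * δ ^ d * f (δ • siteToE x)) * φ x := by
  rw [finLatticeField_apply]
  exact Finset.sum_congr rfl fun x _ => by ring

/-- Exponential moments of the smeared box field exist under the free-boundary `φ⁴` box
measures (`g > 0`). [folklore] -/
theorem integrable_exp_mul_eval_latticeFieldLaw_phi4BoxMeasure (R : ℕ) {g : ℝ} (hg : 0 < g)
    (κ J δ ρ : ℝ) (f : 𝓢(EuclideanSpace ℝ (Fin d), ℝ)) (t : ℝ) :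
    Integrable (fun ω : FieldConfig (EuclideanSpace ℝ (Fin d)) => Real.exp (t * ω f))
      (latticeFieldLaw (phi4BoxMeasure d R g κ J) (box d R) δ ρ) := by
  rw [integrable_latticeFieldLaw_eval_iff _ _ _ _ f (by fun_prop : Measurable fun u : ℝ =>
    Real.exp (t * u))]
  simp_rw [finLatticeField_apply_eq_sum]
  exact integrable_exp_mul_sum_phi4FreeMeasure (box d R) hg κ J (box d R) _ t

/-- Second and fourth moments of the smeared box field exist under the free-boundary `φ⁴` box
measures (`g > 0`). [folklore] -/
theorem integrable_pow_eval_latticeFieldLaw_phi4BoxMeasure (R : ℕ) {g : ℝ} (hg : 0 < g)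
    (κ J δ ρ : ℝ) (f : 𝓢(EuclideanSpace ℝ (Fin d), ℝ)) {n : ℕ} (hn : n = 2 ∨ n = 4) :
    Integrable (fun ω : FieldConfig (EuclideanSpace ℝ (Fin d)) => (ω f) ^ n)
      (latticeFieldLaw (phi4BoxMeasure d R g κ J) (box d R) δ ρ) := by
  rw [integrable_latticeFieldLaw_eval_iff _ _ _ _ f (by fun_prop : Measurable fun u : ℝ => u ^ n)]
  simp_rw [finLatticeField_apply_eq_sum]
  exact integrable_pow_sum_phi4FreeMeasure (box d R) hg κ J (box d R) _ hn

/-! ### Identification of the thermodynamic limit in law with the box limits -/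

section Identification

variable {g κ J δ ρ : ℝ} {ν : Measure (FieldConfig (EuclideanSpace ℝ (Fin d)))}
  {f : 𝓢(EuclideanSpace ℝ (Fin d), ℝ)} {r : ℝ}

/-- Eventually in the box, the smeared box field is the full lattice sum. [folklore] -/
theorem eventually_finLatticeField_box_eq_fullSum (hδ : δ ≠ 0) (ρ : ℝ)
    (f : 𝓢(EuclideanSpace ℝ (Fin d), ℝ)) (hf : ∀ x, f x ≠ 0 → ∀ i, |x i| ≤ r) :
    ∀ᶠ R : ℕ in atTop, ∀ φ : LSite d → ℝ,
      finLatticeField (box d R) δ ρ φ f =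
        ρ * δ ^ d * ∑ x ∈ latticeBox d (r / |δ|), f (δ • siteToE x) * φ x := by
  filter_upwards [eventually_finLatticeField_box_eq hδ ρ f hf] with R hR φ
  rw [hR φ, finsum_smearField_eq_sum hδ hf]

/-- **Exponential moments of the thermodynamic limit in law are the box limits.** Let `ν` be the
limit in law, as the box `R → ∞`, of the laws of the smeared field `Φ_{δ,R}(f)` under the
free-boundary `φ⁴` box measures (`g > 0`, mesh `δ ≠ 0`), and let `f` vanish outside `[-r, r]ᵈ`.
If the box expectations of `exp(t S(φ))`, `S(φ) = ρ δᵈ ∑_x f(δ x) φ_x` the full lattice sum,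
converge to `m(t)` for every real `t`, then every exponential moment of `ω(f)` under `ν` exists
and equals `m`: `∫ e^{w ω(f)} dν = m(w)`. (Uniform integrability from the bound at `2w`,
`tendsto_integral_exp_eval_of_tendstoInLaw`.) [folklore] -/
theorem integral_exp_eval_eq_of_thermodynamicLimit (hg : 0 < g) (hδ : δ ≠ 0)
    (hν : TendstoInLaw (fun R : ℕ =>
      latticeFieldLaw (phi4BoxMeasure d R g κ J) (box d R) δ ρ) atTop ν)
    (hf : ∀ x, f x ≠ 0 → ∀ i, |x i| ≤ r) {m : ℝ → ℝ}
    (hm : ∀ t : ℝ, Tendsto (fun R : ℕ => ∫ φ, Real.exp (t *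
        (ρ * δ ^ d * ∑ x ∈ latticeBox d (r / |δ|), f (δ • siteToE x) * φ x))
          ∂(phi4BoxMeasure d R g κ J)) atTop (𝓝 (m t)))
    (w : ℝ) :
    Integrable (fun ω : FieldConfig (EuclideanSpace ℝ (Fin d)) => Real.exp (w * ω f)) ν ∧
      ∫ ω, Real.exp (w * ω f) ∂ν = m w := by
  have hprob : ∀ᶠ R : ℕ in atTop, IsProbabilityMeasure
      (latticeFieldLaw (phi4BoxMeasure d R g κ J) (box d R) δ ρ) :=
    Eventually.of_forall fun R => by
      haveI := isProbabilityMeasure_phi4BoxMeasure d R hg κ J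
      infer_instance
  -- the exponential moments of the box laws are eventually the box expectations of `exp(t S)`
  have hE : ∀ t : ℝ, Tendsto (fun R : ℕ => ∫ ω, Real.exp (t * ω f)
      ∂(latticeFieldLaw (phi4BoxMeasure d R g κ J) (box d R) δ ρ)) atTop (𝓝 (m t)) := by
    intro t
    refine (hm t).congr' ?_
    filter_upwards [eventually_finLatticeField_box_eq_fullSum hδ ρ f hf] with R hR
    rw [integral_latticeFieldLaw_eval _ _ _ _ f (by fun_prop : Measurable fun u : ℝ =>
      Real.exp (t * u))]
    exact integral_congr_ae (Eventually.of_forall fun φ => by simp only [hR φ])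
  have hB : ∀ᶠ R : ℕ in atTop,
      Integrable (fun ω : FieldConfig (EuclideanSpace ℝ (Fin d)) => Real.exp (2 * w * ω f))
        (latticeFieldLaw (phi4BoxMeasure d R g κ J) (box d R) δ ρ) ∧
      ∫ ω, Real.exp (2 * w * ω f) ∂(latticeFieldLaw (phi4BoxMeasure d R g κ J) (box d R) δ ρ)
        ≤ m (2 * w) + 1 := by
    filter_upwards [(hE (2 * w)).eventually (Iic_mem_nhds (lt_add_one _))] with R hR
    exact ⟨integrable_exp_mul_eval_latticeFieldLaw_phi4BoxMeasure R hg κ J δ ρ f (2 * w), hR⟩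
  obtain ⟨hint, hlim⟩ := tendsto_integral_exp_eval_of_tendstoInLaw hprob hν f w hB
  exact ⟨hint, tendsto_nhds_unique hlim (hE w)⟩

/-- **Second moments of the thermodynamic limit in law are the box limits** (same setting):
if the box expectations of `S(φ)²` converge to `V` and those of `e^{±S(φ)}` converge, then
`ω(f) ∈ L²(ν)` and `∫ ω(f)² dν = V` (uniform fourth-moment bound from the exponential moments,
`tendsto_integral_sq_eval_of_tendstoInLaw`). [folklore] -/
theorem integral_sq_eval_eq_of_thermodynamicLimit (hg : 0 < g) (hδ : δ ≠ 0)
    (hν : TendstoInLaw (fun R : ℕ =>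
      latticeFieldLaw (phi4BoxMeasure d R g κ J) (box d R) δ ρ) atTop ν)
    (hf : ∀ x, f x ≠ 0 → ∀ i, |x i| ≤ r) {V m₁ m₂ : ℝ}
    (hV : Tendsto (fun R : ℕ => ∫ φ,
        (ρ * δ ^ d * ∑ x ∈ latticeBox d (r / |δ|), f (δ • siteToE x) * φ x) ^ 2
          ∂(phi4BoxMeasure d R g κ J)) atTop (𝓝 V))
    (hm₁ : Tendsto (fun R : ℕ => ∫ φ, Real.exp (1 *
        (ρ * δ ^ d * ∑ x ∈ latticeBox d (r / |δ|), f (δ • siteToE x) * φ x))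
          ∂(phi4BoxMeasure d R g κ J)) atTop (𝓝 m₁))
    (hm₂ : Tendsto (fun R : ℕ => ∫ φ, Real.exp ((-1) *
        (ρ * δ ^ d * ∑ x ∈ latticeBox d (r / |δ|), f (δ • siteToE x) * φ x))
          ∂(phi4BoxMeasure d R g κ J)) atTop (𝓝 m₂)) :
    Integrable (fun ω : FieldConfig (EuclideanSpace ℝ (Fin d)) => (ω f) ^ 2) ν ∧
      ∫ ω, (ω f) ^ 2 ∂ν = V := by
  have hprob : ∀ᶠ R : ℕ in atTop, IsProbabilityMeasure
      (latticeFieldLaw (phi4BoxMeasure d R g κ J) (box d R) δ ρ) :=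
    Eventually.of_forall fun R => by
      haveI := isProbabilityMeasure_phi4BoxMeasure d R hg κ J
      infer_instance
  have hEq := eventually_finLatticeField_box_eq_fullSum hδ ρ f hf
  -- exponential moments at `±1` of the box laws, eventually bounded
  have hE : ∀ (t mt : ℝ), Tendsto (fun R : ℕ => ∫ φ, Real.exp (t *
        (ρ * δ ^ d * ∑ x ∈ latticeBox d (r / |δ|), f (δ • siteToE x) * φ x))
          ∂(phi4BoxMeasure d R g κ J)) atTop (𝓝 mt) →
      ∀ᶠ R : ℕ in atTop, ∫ ω, Real.exp (t * ω f)
        ∂(latticeFieldLaw (phi4BoxMeasure d R g κ J) (box d R) δ ρ) ≤ mt + 1 := by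
    intro t mt ht
    filter_upwards [ht.eventually (Iic_mem_nhds (lt_add_one _)), hEq] with R hR hR'
    rw [integral_latticeFieldLaw_eval _ _ _ _ f (by fun_prop : Measurable fun u : ℝ =>
      Real.exp (t * u))]
    refine le_of_eq_of_le (integral_congr_ae (Eventually.of_forall fun φ => ?_)) hR
    simp only [hR' φ]
  have hB : ∀ᶠ R : ℕ in atTop,
      Integrable (fun ω : FieldConfig (EuclideanSpace ℝ (Fin d)) => (ω f) ^ 4)
        (latticeFieldLaw (phi4BoxMeasure d R g κ J) (box d R) δ ρ) ∧
      ∫ ω, (ω f) ^ 4 ∂(latticeFieldLaw (phi4BoxMeasure d R g κ J) (box d R) δ ρ)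
        ≤ 24 * ((m₁ + 1) + (m₂ + 1)) := by
    filter_upwards [hE 1 m₁ hm₁, hE (-1) m₂ hm₂] with R h₁ h₂
    set νR := latticeFieldLaw (phi4BoxMeasure d R g κ J) (box d R) δ ρ
    have hi4 : Integrable (fun ω : FieldConfig (EuclideanSpace ℝ (Fin d)) => (ω f) ^ 4) νR :=
      integrable_pow_eval_latticeFieldLaw_phi4BoxMeasure R hg κ J δ ρ f (Or.inr rfl)
    have hie : ∀ t : ℝ, Integrable (fun ω : FieldConfig (EuclideanSpace ℝ (Fin d)) =>
        Real.exp (t * ω f)) νR :=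
      fun t => integrable_exp_mul_eval_latticeFieldLaw_phi4BoxMeasure R hg κ J δ ρ f t
    refine ⟨hi4, ?_⟩
    calc ∫ ω, (ω f) ^ 4 ∂νR
        ≤ ∫ ω, 24 * (Real.exp (1 * ω f) + Real.exp ((-1) * ω f)) ∂νR := by
          refine integral_mono hi4 (((hie 1).add (hie (-1))).const_mul 24) fun ω => ?_
          have := pow_four_le_exp_add_exp_neg (ω f)
          simpa only [one_mul, neg_one_mul] using this
      _ = 24 * (∫ ω, Real.exp (1 * ω f) ∂νR + ∫ ω, Real.exp ((-1) * ω f) ∂νR) := by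
          rw [integral_const_mul, integral_add (hie 1) (hie (-1))]
      _ ≤ 24 * ((m₁ + 1) + (m₂ + 1)) := by gcongr
  obtain ⟨hint, hlim⟩ := tendsto_integral_sq_eval_of_tendstoInLaw hprob hν f hB
  refine ⟨hint, tendsto_nhds_unique hlim (hV.congr' ?_)⟩
  filter_upwards [hEq] with R hR
  rw [integral_latticeFieldLaw_eval _ _ _ _ f (by fun_prop : Measurable fun u : ℝ => u ^ 2)]
  exact integral_congr_ae (Eventually.of_forall fun φ => by simp only [hR φ])

end Identification


/-! ### The printed objects: infinite-volume expectations, `Σ_L` and `T_{f,L}` for lattice `φ⁴` -/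

/-- Finite-volume (free boundary condition) expectation of an observable `F` of the lattice `φ⁴`
field on `ℤᵈ`: `⟨F⟩_{Λ; g,κ,J} = ∫ F dμ_{Λ; g,κ,J}` (`phi4FreeMeasure`), as a function of the
volume `Λ`, so that `HasBoxLimit (phi4BoxExpect d g κ J F) a` says that the thermodynamic limit
`⟨F⟩_{g,κ,J} = lim_{Λ ↑ ℤᵈ} ⟨F⟩_Λ` along the boxes `box d R` exists and equals `a` — "the states'
natural infinite volume limit" `⟨·⟩_{ρ,β}` of Aizenman–Duminil-Copin 2021, §5 (p. 16), for the
free-boundary states. [cite: AizenmanDuminilCopinAnnals2021, §5 (p. 16: ⟨·⟩_{Λ,ρ,β}, ⟨·⟩_{ρ,β})] -/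
def phi4BoxExpect (d : ℕ) (g κ J : ℝ) (F : (LSite d → ℝ) → ℝ) (Λ : Finset (LSite d)) : ℝ :=
  ∫ φ, F φ ∂(phi4FreeMeasure d Λ g κ J)

/-- Unfolding `phi4BoxExpect` along boxes: the expectation under `phi4BoxMeasure`. [folklore] -/
theorem phi4BoxExpect_box (d : ℕ) (g κ J : ℝ) (F : (LSite d → ℝ) → ℝ) (R : ℕ) :
    phi4BoxExpect d g κ J F (box d R) = ∫ φ, F φ ∂(phi4BoxMeasure d R g κ J) := rfl

/-- `HasBoxLimit (phi4BoxExpect d g κ J F) a` unfolded: the box expectations converge to `a`.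
[folklore] -/
theorem hasBoxLimit_phi4BoxExpect_iff {g κ J : ℝ} {F : (LSite d → ℝ) → ℝ} {a : ℝ} :
    HasBoxLimit (phi4BoxExpect d g κ J F) a ↔
      Tendsto (fun R : ℕ => ∫ φ, F φ ∂(phi4BoxMeasure d R g κ J)) atTop (𝓝 a) := Iff.rfl

/-- **The block variable's second moment `Σ_L`** of Aizenman–Duminil-Copin ("`Σ_L` denotes the
variance of the sum of spins over the box of size `L`", §1.2, p. 4, for the infinite-volume state):
`Σ_L(g,κ,J) = lim_{Λ ↑ ℤᵈ} ⟨(∑_{x ∈ Λ_L} φ_x)²⟩_{Λ; g,κ,J}` along boxes (`boxLim`; junk-valued if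
the box limit does not exist, exactly as `phi4TwoPoint`). [cite: AizenmanDuminilCopinAnnals2021, §1.2 (p. 4), Def. 1.1] -/
def phi4BlockVariance (d : ℕ) (g κ J L : ℝ) : ℝ :=
  boxLim (phi4BoxExpect d g κ J fun φ => (∑ x ∈ latticeBox d L, φ x) ^ 2)

/-- **The block-spin-normalised smeared field `T_{f,L}`** of Aizenman–Duminil-Copin for the
lattice `φ⁴` field, `T_{f,L}(φ) = Σ_L^{-1/2} ∑_{x ∈ ℤᵈ} f(x/L) φ_x` (§1.2, p. 4; Prop. 7.2,
p. 28, for the GS class with `τ = φ`), with the infinite-volume `Σ_L = phi4BlockVariance`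
(a `finsum`, finite for compactly supported `f` and `L ≠ 0`; `Σ_L^{-1/2}` is junk `0` if
`Σ_L ≤ 0`). Twin of `Literature.Probability.LatticeModels.normalizedField` (Ising).
[cite: AizenmanDuminilCopinAnnals2021, §1.2 (p. 4) and Prop. 7.2 (p. 28)] -/
def phi4NormalizedField (d : ℕ) (g κ J L : ℝ) (f : EuclideanSpace ℝ (Fin d) → ℝ)
    (φ : LSite d → ℝ) : ℝ :=
  (Real.sqrt (phi4BlockVariance d g κ J L))⁻¹ * ∑ᶠ x : LSite d, f (L⁻¹ • siteToE x) * φ x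

/-- `T_{f,L}` as a finite sum, for `L ≠ 0` and `f` vanishing outside `[-r, r]ᵈ`. [folklore] -/
theorem phi4NormalizedField_eq_sum {g κ J L r : ℝ} (hL : L ≠ 0)
    {f : EuclideanSpace ℝ (Fin d) → ℝ} (hf : ∀ x, f x ≠ 0 → ∀ i, |x i| ≤ r) (φ : LSite d → ℝ) :
    phi4NormalizedField d g κ J L f φ = (Real.sqrt (phi4BlockVariance d g κ J L))⁻¹ *
      ∑ x ∈ latticeBox d (r / |L⁻¹|), f (L⁻¹ • siteToE x) * φ x := by
  rw [phi4NormalizedField, finsum_smearField_eq_sum (inv_ne_zero hL) hf]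

/-- If `Σ_L^{-1/2}` vanishes (junk regime), `T_{f,L} ≡ 0`. [folklore] -/
theorem phi4NormalizedField_eq_zero_of_sqrt_eq_zero {g κ J L : ℝ}
    (h : Real.sqrt (phi4BlockVariance d g κ J L) = 0) (f : EuclideanSpace ℝ (Fin d) → ℝ)
    (φ : LSite d → ℝ) : phi4NormalizedField d g κ J L f φ = 0 := by
  rw [phi4NormalizedField, h, inv_zero, zero_mul]

/-- A box limit of the second moment of `T_{f,L}` is `0` in the junk regime `Σ_L^{-1/2} = 0`.
[folklore] -/
theorem eq_zero_of_hasBoxLimit_sq_of_sqrt_eq_zero {g κ J L : ℝ}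
    (h : Real.sqrt (phi4BlockVariance d g κ J L) = 0) {f : EuclideanSpace ℝ (Fin d) → ℝ} {v : ℝ}
    (hv : HasBoxLimit (phi4BoxExpect d g κ J fun φ => phi4NormalizedField d g κ J L f φ ^ 2) v) :
    v = 0 := by
  refine tendsto_nhds_unique hv ?_
  simp only [phi4BoxExpect, phi4NormalizedField_eq_zero_of_sqrt_eq_zero h, zero_pow two_ne_zero,
    integral_zero]
  exact tendsto_const_nhds

/-- **Dilation and normalisation.** For `M ≠ 0`, `δ ≠ 0`, `L = (M δ)⁻¹` and
`f_M = f(·/M)`: `f_M(x/L) = f(δ x)`, so the full lattice sum of the smeared field at mesh `δ` is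
a constant multiple of the normalised field of the dilate at scale `L`,
`ρ δᵈ ∑_x f(δ x) φ_x = (ρ δᵈ Σ_L^{1/2}) · T_{f_M, L}(φ)`, as soon as `Σ_L^{1/2} ≠ 0`.
[cite: AizenmanDuminilCopinAnnals2021, §1.2 (p. 4)] -/
theorem fullSum_eq_mul_phi4NormalizedField {g κ J M δ r : ℝ} (hM : M ≠ 0) (hδ : δ ≠ 0) (ρ : ℝ)
    {f : EuclideanSpace ℝ (Fin d) → ℝ} (hf : ∀ x, f x ≠ 0 → ∀ i, |x i| ≤ r)
    (hS : Real.sqrt (phi4BlockVariance d g κ J (M * δ)⁻¹) ≠ 0) (φ : LSite d → ℝ) :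
    ρ * δ ^ d * ∑ x ∈ latticeBox d (r / |δ|), f (δ • siteToE x) * φ x =
      (ρ * δ ^ d * Real.sqrt (phi4BlockVariance d g κ J (M * δ)⁻¹)) *
        phi4NormalizedField d g κ J (M * δ)⁻¹ (fun y => f (M⁻¹ • y)) φ := by
  have hdil : ∀ x : LSite d, f (M⁻¹ • ((M * δ)⁻¹)⁻¹ • siteToE x) = f (δ • siteToE x) := by
    intro x
    rw [inv_inv, smul_smul, inv_mul_cancel_left₀ hM]
  simp only [phi4NormalizedField, hdil]
  rw [finsum_smearField_eq_sum hδ hf, mul_assoc (ρ * δ ^ d), ← mul_assoc (Real.sqrt _),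
    mul_inv_cancel₀ hS, one_mul]

/-- The sup norm is dilation invariant: `‖f(·/M)‖_∞ = ‖f‖_∞` (`M ≠ 0`). [folklore] -/
theorem iSup_abs_dilate {f : EuclideanSpace ℝ (Fin d) → ℝ} {M : ℝ} (hM : M ≠ 0) :
    (⨆ x, |(fun y => f (M⁻¹ • y)) x|) = ⨆ x, |f x| := by
  have hsurj : Function.Surjective fun y : EuclideanSpace ℝ (Fin d) => M⁻¹ • y := fun x =>
    ⟨M • x, by simp only [smul_smul, inv_mul_cancel₀ hM, one_smul]⟩
  exact hsurj.iSup_comp (g := fun x => |f x|)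

/-- The dilate of a continuous function is continuous. [folklore] -/
theorem continuous_dilate {f : EuclideanSpace ℝ (Fin d) → ℝ} (hf : Continuous f) (M : ℝ) :
    Continuous fun y : EuclideanSpace ℝ (Fin d) => f (M⁻¹ • y) :=
  hf.comp (continuous_const_smul M⁻¹)

/-- The dilate of a compactly supported function is compactly supported (`M ≠ 0`). [folklore] -/
theorem hasCompactSupport_dilate {f : EuclideanSpace ℝ (Fin d) → ℝ} (hf : HasCompactSupport f)
    {M : ℝ} (hM : M ≠ 0) :
    HasCompactSupport fun y : EuclideanSpace ℝ (Fin d) => f (M⁻¹ • y) :=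
  hf.comp_homeomorph (Homeomorph.smulOfNeZero M⁻¹ (inv_ne_zero hM))


/-! ### A non-negative compactly supported Schwartz bump -/

/-- A smooth bump on `ℝᵈ`: a Schwartz function with compact support in `[-2, 2]ᵈ`, values in
`[0, 1]`, equal to `1` at the origin. [folklore] -/
theorem exists_schwartz_cubeBump (d : ℕ) :
    ∃ f₀ : 𝓢(EuclideanSpace ℝ (Fin d), ℝ), HasCompactSupport f₀ ∧ (∀ x, 0 ≤ f₀ x) ∧ f₀ 0 = 1 ∧
      ∀ x, f₀ x ≠ 0 → ∀ i, |x i| ≤ 2 := by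
  let b : ContDiffBump (0 : EuclideanSpace ℝ (Fin d)) := ⟨1, 2, one_pos, one_lt_two⟩
  have hbs : HasCompactSupport (b : EuclideanSpace ℝ (Fin d) → ℝ) := b.hasCompactSupport
  have hbd : ContDiff ℝ ((⊤ : ℕ∞) : WithTop ℕ∞) (b : EuclideanSpace ℝ (Fin d) → ℝ) := b.contDiff
  refine ⟨hbs.toSchwartzMap hbd, hbs, fun x => b.nonneg, ?_, fun x hx i => ?_⟩
  · exact b.one_of_mem_closedBall (Metric.mem_closedBall_self one_pos.le)
  · have hx' : x ∈ Function.support (b : EuclideanSpace ℝ (Fin d) → ℝ) := hx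
    rw [b.support_eq, Metric.mem_ball, dist_zero_right] at hx'
    calc |x i| = ‖x i‖ := (Real.norm_eq_abs _).symm
      _ ≤ ‖x‖ := PiLp.norm_apply_le x i
      _ ≤ 2 := hx'.le

/-! ### `phi44_triviality` from the printed exponential-moment estimate -/

/-- Rescaling to the printed window: `δ ↦ M δ` maps `𝓝[>] 0` to itself (`M > 0`). [folklore] -/
theorem tendsto_const_mul_nhdsGT_zero {M : ℝ} (hM : 0 < M) :
    Tendsto (fun δ : ℝ => M * δ) (𝓝[>] 0) (𝓝[>] 0) := by
  refine tendsto_nhdsWithin_iff.2 ⟨?_, ?_⟩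
  · have h : Tendsto (fun δ : ℝ => M * δ) (𝓝 0) (𝓝 (M * 0)) :=
      (continuous_const.mul continuous_id).tendsto 0
    rw [mul_zero] at h
    exact h.mono_left nhdsWithin_le_nhds
  · exact (eventually_mem_nhdsWithin (a := (0 : ℝ)) (s := Set.Ioi 0)).mono
      fun δ hδ => mul_pos hM hδ

/-- **`phi44_triviality` (Aizenman–Duminil-Copin 2021, Thm 1.2 for lattice `φ⁴₄`) from the
printed inputs at the level of the printed objects.** The two hypotheses transcribe, for the
free-boundary infinite-volume lattice `φ⁴` state on `ℤ⁴` — realised as the box limit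
(`HasBoxLimit`) of the expectations `phi4BoxExpect` under `phi4BoxMeasure 4 R g κ J`, "the states'
natural infinite volume limit" of §5 — and for the block-spin-normalised field
`T_{f,L} = Σ_L^{-1/2} ∑_x f(x/L) φ_x` (`phi4NormalizedField`):

* `h72` — **Prop. 7.2** (p. 28, GS class, which contains lattice `φ⁴` by §2), in the form its
  proof (§6.3, p. 26) establishes (prefactor `e^{z²⟨T²_{|f|,L}⟩/2}`, cf. the caveat recorded at
  `Literature.Probability.LatticeModels.aizenmanDuminilCopin_mgf_normalizedField_bound`, whose
  twin `…_abs` this is): for `g > 0` and `κ` fixed there are `c, C > 0` such that for all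
  `0 ≤ J ≤ J_c(g,κ)` inside the window `L ≤ ξ` (written, as for the Ising fact, as
  `J = J_c ∨ (0 < J ∧ L · ξ(J)⁻¹ ≤ 1)`, `ξ⁻¹ = invCorrLength (phi4TwoPoint 4 g κ J)`), all
  `1 < L`, `r ≥ 1`, continuous `f` vanishing outside `[-r, r]⁴` and real `z`, the infinite-volume
  limits `m = ⟨e^{z T_{f,L}}⟩`, `v = ⟨T_{f,L}²⟩`, `v' = ⟨T_{|f|,L}²⟩` exist and
  `|m - e^{z² v/2}| ≤ e^{z² v'/2} · C ‖f‖_∞⁴ r¹² z⁴ / (log L)^c`;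
* `hvar` — the **variance bounds of p. 6** (display after Prop. 1.4, "by the Infrared Bound …
  `C r_f² ‖f‖²_∞ ≥ ⟨T_{f,L}²⟩ ≥ c_f > 0` uniformly in `β ≤ β_c` and `L`", used verbatim in the
  deduction of Thm 1.2 from Prop. 7.2, p. 28): for continuous compactly supported `f`,
  `⟨T_{f,L}²⟩ ≤ C_f` for `J ≤ J_c`, `L ≥ 1`, and, for `f ≥ 0`, `f ≢ 0`, `⟨T_{f,L}²⟩ ≥ c_f > 0`
  for `J ≤ J_c`, `L ≥ L₀(f)`.

(Constants may depend on `(g, κ)` and, in `hvar`, on `f`; print has `c, C` uniform over the GS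
class — a stronger hypothesis.) **Conclusion**: the tree's named fact `phi44_triviality`. *Proof*:
the law-level assembly `phi44_triviality_of_scaleBound` (Slutsky renormalisation, Lévy, tightness)
applies to the thermodynamic limits in law `ν_δ` of the restated fact with the scale
`s(δ) = (ρ(δ) δ⁴)² Σ_L`, `L = (M δ)⁻¹` (`M ≥ 1` the window constant: ADC's `L ≤ ξ` is applied to
the dilate `f(·/M)` at scale `L`, `smearedSpin_dilate`-style), once `ν_δ` is identified with the
infinite-volume state: `∫ e^{w ω(f)} dν_δ = ⟨e^{z T_{f_M,L}}⟩` with `z = ρ δ⁴ Σ_L^{1/2} w`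
(`integral_exp_eval_eq_of_thermodynamicLimit`: the box laws' exponential moments are eventually
the box expectations of `e^{z T}`, and pass to the limit in law under the uniform bound supplied
by the convergent moments at `2z`) and `∫ ω(f)² dν_δ = (ρ δ⁴)² Σ_L ⟨T_{f_M,L}²⟩`
(`integral_sq_eval_eq_of_thermodynamicLimit`); `Σ_L > 0` by the lower variance bound. What this
theorem leaves to vendor is exactly the printed `φ⁴₄` substance: Prop. 7.2 (from Thm 7.1, random
currents for the Griffiths–Simon class) and the two variance bounds, for the free-boundary
infinite-volume state. [cite: AizenmanDuminilCopinAnnals2021, Thm 1.2 (p. 4), Prop. 7.2 (p. 28), p. 6 (display after Prop. 1.4), §5 (p. 16), §6.3 (p. 26)] -/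
theorem phi44_triviality_of_prop72
    (h72 : ∀ (g κ : ℝ), 0 < g → ∃ c C : ℝ, 0 < c ∧ 0 < C ∧
      ∀ (J L r : ℝ), 0 ≤ J → J ≤ phi4CriticalJ 4 g κ →
        (J = phi4CriticalJ 4 g κ ∨ (0 < J ∧ L * invCorrLength (phi4TwoPoint 4 g κ J) ≤ 1)) →
        1 < L → 1 ≤ r →
      ∀ f : EuclideanSpace ℝ (Fin 4) → ℝ, Continuous f → (∀ x, f x ≠ 0 → ∀ i, |x i| ≤ r) →
      ∀ z : ℝ, ∃ m v v' : ℝ,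
        HasBoxLimit (phi4BoxExpect 4 g κ J fun φ =>
          Real.exp (z * phi4NormalizedField 4 g κ J L f φ)) m ∧
        HasBoxLimit (phi4BoxExpect 4 g κ J fun φ => phi4NormalizedField 4 g κ J L f φ ^ 2) v ∧
        HasBoxLimit (phi4BoxExpect 4 g κ J fun φ =>
          phi4NormalizedField 4 g κ J L (fun x => |f x|) φ ^ 2) v' ∧
        |m - Real.exp (z ^ 2 / 2 * v)| ≤
          Real.exp (z ^ 2 / 2 * v') * (C * (⨆ x, |f x|) ^ 4 * r ^ 12 * z ^ 4 / Real.log L ^ c))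
    (hvar : ∀ (g κ : ℝ), 0 < g → ∀ f : EuclideanSpace ℝ (Fin 4) → ℝ, Continuous f →
      HasCompactSupport f →
      (∃ C : ℝ, ∀ (J L : ℝ), 0 ≤ J → J ≤ phi4CriticalJ 4 g κ → 1 ≤ L →
        ∃ v : ℝ, HasBoxLimit (phi4BoxExpect 4 g κ J fun φ =>
          phi4NormalizedField 4 g κ J L f φ ^ 2) v ∧ v ≤ C) ∧
      ((∀ x, 0 ≤ f x) → f ≠ 0 → ∃ c L₀ : ℝ, 0 < c ∧
        ∀ (J L : ℝ), 0 ≤ J → J ≤ phi4CriticalJ 4 g κ → L₀ ≤ L →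
        ∃ v : ℝ, HasBoxLimit (phi4BoxExpect 4 g κ J fun φ =>
          phi4NormalizedField 4 g κ J L f φ ^ 2) v ∧ c ≤ v)) :
    phi44_triviality := by
  refine phi44_triviality_of_scaleBound fun g κ hg J ρ ν hJ hM hν => ?_
  obtain ⟨M, hM⟩ := hM
  obtain ⟨c, C, hc, hC, H⟩ := h72 g κ hg
  -- the window constant, normalised to `M' ≥ 1`
  obtain ⟨M', hM'1, hMM'⟩ : ∃ M' : ℝ, 1 ≤ M' ∧ M ≤ M' := ⟨max M 1, le_max_right _ _, le_max_left _ _⟩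
  have hM'0 : 0 < M' := one_pos.trans_le hM'1
  -- the printed scale `L(δ) = (M' δ)⁻¹` and the normalisation `a(δ) = ρ(δ) δ⁴ Σ_L^{1/2}`
  obtain ⟨L, hL⟩ : ∃ L : ℝ → ℝ, ∀ δ, L δ = (M' * δ)⁻¹ := ⟨_, fun _ => rfl⟩
  obtain ⟨a, ha⟩ : ∃ a : ℝ → ℝ, ∀ δ,
      a δ = ρ δ * δ ^ 4 * Real.sqrt (phi4BlockVariance 4 g κ (J δ) (L δ)) := ⟨_, fun _ => rfl⟩
  have hLtop : Tendsto L (𝓝[>] 0) atTop := by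
    rw [show L = fun δ => (M' * δ)⁻¹ from funext hL]
    exact tendsto_inv_nhdsGT_zero.comp (tendsto_const_mul_nhdsGT_zero hM'0)
  have hδpos : ∀ᶠ δ in 𝓝[>] (0 : ℝ), 0 < δ := eventually_mem_nhdsWithin
  -- the window in printed form at scale `L(δ)`
  have hwin : ∀ᶠ δ in 𝓝[>] (0 : ℝ), J δ = phi4CriticalJ 4 g κ ∨
      (0 < J δ ∧ L δ * invCorrLength (phi4TwoPoint 4 g κ (J δ)) ≤ 1) := by
    filter_upwards [hM, hδpos] with δ h hδ
    rcases h with h | ⟨hJpos, hle⟩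
    · exact Or.inl h
    · refine Or.inr ⟨hJpos, ?_⟩
      rw [hL, inv_mul_le_iff₀ (mul_pos hM'0 hδ), mul_one]
      exact hle.trans (mul_le_mul_of_nonneg_right hMM' hδ.le)
  -- the bump `f₀` and its dilate `f₀(·/M')`; lower variance bound ⇒ `Σ_L^{1/2} ≠ 0`
  obtain ⟨f₀, hf₀s, hf₀nn, hf₀0, hf₀cube⟩ := exists_schwartz_cubeBump 4
  set f₀M : EuclideanSpace ℝ (Fin 4) → ℝ := fun y => f₀ (M'⁻¹ • y) with hf₀M
  have hf₀Mc : Continuous f₀M := continuous_dilate f₀.continuous M'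
  have hf₀Ms : HasCompactSupport f₀M := hasCompactSupport_dilate hf₀s hM'0.ne'
  have hf₀Mcube : ∀ x, f₀M x ≠ 0 → ∀ i, |x i| ≤ M' * 2 := cube_of_comp_inv_smul hf₀cube hM'0
  have hf₀Mnn : ∀ x, 0 ≤ f₀M x := fun x => hf₀nn _
  have hf₀Mne : f₀M ≠ 0 := fun h => by
    have h0 := congr_fun h 0
    simp only [hf₀M, smul_zero, hf₀0, Pi.zero_apply] at h0
    exact one_ne_zero h0
  obtain ⟨c₀, L₀, hc₀, hlow⟩ := (hvar g κ hg f₀M hf₀Mc hf₀Ms).2 hf₀Mnn hf₀Mne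
  -- the good `δ`
  have hgood : ∀ᶠ δ in 𝓝[>] (0 : ℝ), 0 < δ ∧ (J δ = phi4CriticalJ 4 g κ ∨
      (0 < J δ ∧ L δ * invCorrLength (phi4TwoPoint 4 g κ (J δ)) ≤ 1)) ∧ 1 < L δ ∧ L₀ ≤ L δ := by
    filter_upwards [hδpos, hwin, hLtop.eventually (eventually_gt_atTop 1),
      hLtop.eventually (eventually_ge_atTop L₀)] with δ h1 h2 h3 h4
    exact ⟨h1, h2, h3, h4⟩
  -- at a good `δ`: `Σ_L^{1/2} ≠ 0`, and the full lattice sum is `a(δ) T_{f_M, L}`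
  have hS : ∀ δ, 0 < δ → L₀ ≤ L δ → Real.sqrt (phi4BlockVariance 4 g κ (J δ) (L δ)) ≠ 0 := by
    intro δ hδ hL0 h0
    obtain ⟨v₀, hv₀, hcv₀⟩ := hlow (J δ) (L δ) (hJ δ hδ).1 (hJ δ hδ).2 hL0
    have := eq_zero_of_hasBoxLimit_sq_of_sqrt_eq_zero h0 hv₀
    linarith
  have hfull : ∀ δ, 0 < δ → L₀ ≤ L δ → ∀ {f : EuclideanSpace ℝ (Fin 4) → ℝ} {r : ℝ},
      (∀ x, f x ≠ 0 → ∀ i, |x i| ≤ r) → ∀ φ : LSite 4 → ℝ,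
      ρ δ * δ ^ 4 * ∑ x ∈ latticeBox 4 (r / |δ|), f (δ • siteToE x) * φ x =
        a δ * phi4NormalizedField 4 g κ (J δ) (L δ) (fun y => f (M'⁻¹ • y)) φ := by
    intro δ hδ hL0 f r hf φ
    have hS' := hS δ hδ hL0
    rw [hL] at hS'
    rw [ha, hL]
    exact fullSum_eq_mul_phi4NormalizedField hM'0.ne' hδ.ne' (ρ δ) hf hS' φ
  -- the identification, at a good `δ`, for a continuous `f` vanishing outside `[-r,r]⁴`, `r ≥ 1`
  have hident : ∀ δ, 0 < δ → (J δ = phi4CriticalJ 4 g κ ∨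
      (0 < J δ ∧ L δ * invCorrLength (phi4TwoPoint 4 g κ (J δ)) ≤ 1)) → 1 < L δ → L₀ ≤ L δ →
      ∀ (f : 𝓢(EuclideanSpace ℝ (Fin 4), ℝ)) (r : ℝ), 1 ≤ r → (∀ x, f x ≠ 0 → ∀ i, |x i| ≤ r) →
      ∀ w : ℝ, ∃ m v v' : ℝ,
        (Integrable (fun ω : FieldConfig (EuclideanSpace ℝ (Fin 4)) => Real.exp (w * ω f)) (ν δ) ∧
          ∫ ω, Real.exp (w * ω f) ∂ν δ = m) ∧
        (HasBoxLimit (phi4BoxExpect 4 g κ (J δ) fun φ =>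
          phi4NormalizedField 4 g κ (J δ) (L δ) (fun x => f (M'⁻¹ • x)) φ ^ 2) v ∧
          ∫ ω, (ω f) ^ 2 ∂ν δ = a δ ^ 2 * v) ∧
        HasBoxLimit (phi4BoxExpect 4 g κ (J δ) fun φ =>
          phi4NormalizedField 4 g κ (J δ) (L δ) (fun x => |f (M'⁻¹ • x)|) φ ^ 2) v' ∧
        |m - Real.exp ((a δ * w) ^ 2 / 2 * v)| ≤ Real.exp ((a δ * w) ^ 2 / 2 * v') *
          (C * (⨆ x, |f x|) ^ 4 * (M' * r) ^ 12 * (a δ * w) ^ 4 / Real.log (L δ) ^ c) := by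
    intro δ hδ hwinδ hL1 hL0 f r hr1 hfr w
    set fM : EuclideanSpace ℝ (Fin 4) → ℝ := fun y => f (M'⁻¹ • y) with hfM
    have hfMc : Continuous fM := continuous_dilate f.continuous M'
    have hfMcube : ∀ x, fM x ≠ 0 → ∀ i, |x i| ≤ M' * r := cube_of_comp_inv_smul hfr hM'0
    have hr' : 1 ≤ M' * r := one_le_mul_of_one_le_of_one_le hM'1 hr1
    have Hf := H (J δ) (L δ) (M' * r) (hJ δ hδ).1 (hJ δ hδ).2 hwinδ hL1 hr' fM hfMc hfMcube
    -- box limits of the exponential moments of `T_{f_M,L}` at all `z`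
    have Hz : ∀ z : ℝ, ∃ m : ℝ, HasBoxLimit (phi4BoxExpect 4 g κ (J δ) fun φ =>
        Real.exp (z * phi4NormalizedField 4 g κ (J δ) (L δ) fM φ)) m := fun z => by
      obtain ⟨m, v, v', hm, -, -, -⟩ := Hf z
      exact ⟨m, hm⟩
    choose mT hmT using Hz
    -- the identification of exponential moments
    have hexp : ∀ t : ℝ, Integrable (fun ω : FieldConfig (EuclideanSpace ℝ (Fin 4)) =>
        Real.exp (t * ω f)) (ν δ) ∧ ∫ ω, Real.exp (t * ω f) ∂ν δ = mT (t * a δ) := by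
      intro t
      refine integral_exp_eval_eq_of_thermodynamicLimit (d := 4) hg hδ.ne' (hν δ hδ) hfr
        (m := fun t => mT (t * a δ)) (fun t' => ?_) t
      have h := (hasBoxLimit_phi4BoxExpect_iff.1 (hmT (t' * a δ)))
      refine h.congr' (Eventually.of_forall fun R => integral_congr_ae
        (Eventually.of_forall fun φ => ?_))
      simp only [hfull δ hδ hL0 hfr φ, mul_assoc, hfM]
    obtain ⟨m, v, v', hm, hv, hv', hbd⟩ := Hf (a δ * w)
    refine ⟨m, v, v', ?_, ⟨hv, ?_⟩, hv', ?_⟩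
    · have h1 := hexp w
      have h2 : mT (w * a δ) = m := by
        refine tendsto_nhds_unique (hmT (w * a δ)) ?_
        rw [mul_comm w (a δ)]
        exact hm
      exact ⟨h1.1, h1.2.trans h2⟩
    · refine (integral_sq_eval_eq_of_thermodynamicLimit (d := 4) hg hδ.ne' (hν δ hδ) hfr
        (V := a δ ^ 2 * v) (m₁ := mT (1 * a δ)) (m₂ := mT ((-1) * a δ)) ?_ ?_ ?_).2
      · have h := (hasBoxLimit_phi4BoxExpect_iff.1 hv).const_mul (a δ ^ 2)
        refine h.congr' (Eventually.of_forall fun R => ?_)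
        rw [← integral_const_mul]
        refine integral_congr_ae (Eventually.of_forall fun φ => ?_)
        simp only [hfull δ hδ hL0 hfr φ, mul_pow, hfM]
      · have h := (hasBoxLimit_phi4BoxExpect_iff.1 (hmT (1 * a δ)))
        refine h.congr' (Eventually.of_forall fun R => integral_congr_ae
          (Eventually.of_forall fun φ => ?_))
        simp only [hfull δ hδ hL0 hfr φ, mul_assoc, hfM]
      · have h := (hasBoxLimit_phi4BoxExpect_iff.1 (hmT ((-1) * a δ)))
        refine h.congr' (Eventually.of_forall fun R => integral_congr_ae
          (Eventually.of_forall fun φ => ?_))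
        simp only [hfull δ hδ hL0 hfr φ, mul_assoc, hfM]
    · rwa [iSup_abs_dilate hM'0.ne'] at hbd
  -- the data for `phi44_triviality_of_scaleBound`
  refine ⟨fun δ => a δ ^ 2, Eventually.of_forall fun δ => sq_nonneg _, ?_, ?_⟩
  · -- (i) the lower variance bound for the bump `f₀`
    refine ⟨f₀, c₀, hf₀s, hc₀, ?_⟩
    filter_upwards [hgood] with δ ⟨hδ, hwinδ, hL1, hL0⟩
    obtain ⟨m, v, v', -, ⟨hvlim, hv⟩, -, -⟩ :=
      hident δ hδ hwinδ hL1 hL0 f₀ 2 (by norm_num) hf₀cube 0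
    obtain ⟨v₀, hv₀, hcv₀⟩ := hlow (J δ) (L δ) (hJ δ hδ).1 (hJ δ hδ).2 hL0
    have hvv : v = v₀ := tendsto_nhds_unique hvlim hv₀
    rw [hv, hvv, mul_comm]
    exact mul_le_mul_of_nonneg_left hcv₀ (sq_nonneg _)
  · -- (ii) the scale-covariant exponential-moment bound
    intro f hfc
    obtain ⟨r, hr1, hfr⟩ := exists_cube_of_hasCompactSupport f hfc
    set fM : EuclideanSpace ℝ (Fin 4) → ℝ := fun y => f (M'⁻¹ • y) with hfM
    have hfMc : Continuous fM := continuous_dilate f.continuous M'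
    have hfMs : HasCompactSupport fM := hasCompactSupport_dilate hfc hM'0.ne'
    obtain ⟨Cabs, hCabs⟩ := (hvar g κ hg (fun x => |fM x|) hfMc.abs
      (hfMs.comp_left (g := fun t : ℝ => |t|) abs_zero)).1
    set C' : ℝ := max Cabs 0 with hC'
    set K : ℝ → ℝ := fun δ => C * (⨆ x, |f x|) ^ 4 * (M' * r) ^ 12 / Real.log (L δ) ^ c with hK
    set G : ℝ → ℝ := fun t => t ^ 2 * Real.exp (C' * t / 2) with hG
    refine ⟨K, G, ?_, ?_, ?_, ?_⟩
    · -- `K(δ) → 0`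
      have hu : Tendsto (fun δ => (Real.log (L δ) ^ c)⁻¹) (𝓝[>] (0 : ℝ)) (𝓝 0) :=
        tendsto_inv_atTop_zero.comp
          ((tendsto_rpow_atTop hc).comp (Real.tendsto_log_atTop.comp hLtop))
      have := tendsto_const_nhds (x := C * (⨆ x, |f x|) ^ 4 * (M' * r) ^ 12) |>.mul hu
      simpa [hK, div_eq_mul_inv] using this
    · -- `G` is monotone on `[0, ∞)`
      intro s hs t _ hst
      have hs0 : 0 ≤ s := hs
      have hC'0 : 0 ≤ C' := le_max_right _ _
      exact mul_le_mul (pow_le_pow_left₀ hs0 hst 2)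
        (Real.exp_le_exp.2 (by nlinarith)) (Real.exp_pos _).le (sq_nonneg t)
    · -- exponential moments exist
      filter_upwards [hgood] with δ ⟨hδ, hwinδ, hL1, hL0⟩ w
      obtain ⟨m, v, v', hm, -, -, -⟩ := hident δ hδ hwinδ hL1 hL0 f r hr1 hfr w
      exact hm.1
    · -- the bound
      filter_upwards [hgood] with δ ⟨hδ, hwinδ, hL1, hL0⟩ w
      obtain ⟨m, v, v', hm, ⟨-, hv⟩, hv', hbd⟩ := hident δ hδ hwinδ hL1 hL0 f r hr1 hfr w
      obtain ⟨v'', hv'', hv''C⟩ := hCabs (J δ) (L δ) (hJ δ hδ).1 (hJ δ hδ).2 hL1.le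
      have hvv : v' = v'' := tendsto_nhds_unique hv' hv''
      have hv'C : v' ≤ C' := (hvv.le.trans hv''C).trans (le_max_left _ _)
      rw [hm.2, hv]
      have hlhs : Real.exp (w ^ 2 * (a δ ^ 2 * v) / 2) = Real.exp ((a δ * w) ^ 2 / 2 * v) := by
        congr 1
        ring
      rw [hlhs]
      refine hbd.trans ?_
      have hK0 : 0 ≤ K δ := by
        simp only [hK]
        exact div_nonneg (by positivity) (Real.rpow_nonneg (Real.log_nonneg hL1.le) c)
      have hP : C * (⨆ x, |f x|) ^ 4 * (M' * r) ^ 12 * (a δ * w) ^ 4 / Real.log (L δ) ^ c =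
          K δ * (a δ ^ 2 * w ^ 2) ^ 2 := by
        simp only [hK]
        ring
      have hexpC : Real.exp ((a δ * w) ^ 2 / 2 * v') ≤ Real.exp (C' * (a δ ^ 2 * w ^ 2) / 2) := by
        refine Real.exp_le_exp.2 ?_
        have h0 : 0 ≤ (a δ * w) ^ 2 / 2 := by positivity
        calc (a δ * w) ^ 2 / 2 * v' ≤ (a δ * w) ^ 2 / 2 * C' :=
            mul_le_mul_of_nonneg_left hv'C h0
          _ = C' * (a δ ^ 2 * w ^ 2) / 2 := by ring
      calc Real.exp ((a δ * w) ^ 2 / 2 * v') *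
            (C * (⨆ x, |f x|) ^ 4 * (M' * r) ^ 12 * (a δ * w) ^ 4 / Real.log (L δ) ^ c)
          ≤ Real.exp (C' * (a δ ^ 2 * w ^ 2) / 2) *
            (C * (⨆ x, |f x|) ^ 4 * (M' * r) ^ 12 * (a δ * w) ^ 4 / Real.log (L δ) ^ c) := by
            refine mul_le_mul_of_nonneg_right hexpC ?_
            rw [hP]
            positivity
        _ = K δ * G (a δ ^ 2 * w ^ 2) := by
            rw [hP]
            simp only [hG]
            ring

end Literature.MathematicalPhysics.QuantumFieldTheory

end
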